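import Summits.Parity.BatemanHorn.Theorems.SoloBlindLevel
import Literature.NumberTheory.Sieve.PolynomialCongruencesRootDensity
import Literature.NumberTheory.LFunctions.DegreeOnePrimesPNT
import HarnessLib

/-!
# The ℓ¹ level of distribution of `{f(n) : n ≤ N}` is exactly `N` for EVERY monic irreducible `f` — PROVED

Solo seat `solo-Parity-blind` (summit `Parity`, conjunct `BatemanHorn`), sequel to
`SoloBlindLevel.lean` (the quadratic case): the calibration lemma (C1) of the seat's report in
full generality over the degree.  For `f ∈ ℤ[X]` monic irreducible of degree `d ≥ 1` and the
tree's sifted sequence `polyAPSeq f N 1 0` (`A_m = #{n ≤ N : m ∣ f(n)}`, `X = N`,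
`R_m = A_m − ρ_f(m)N/m`):

* `sum_Ioc_filter_prime_eq_sub` — window sums over the primes of `(U, V]` as differences of
  sums over `Nat.primesLE`;
* `mertens_rootCount` — the tree's prime-ideal-theorem Mertens law for `ρ_f`
  (`DegreeOnePrimes.sum_primesLE_rootCount_div_eq`, `A = 0`) in `polyRootCountMod` form:
  `|∑_{p ≤ x} ρ_f(p)/p − log log x − c_f| ≤ C_f/log x` (`x ≥ 2`);
* `monic_window` — for `2 ≤ U`, `2dN ≤ U ≤ V` and admissible `x`:
  `N · (log log V − log log U − C_f/log V − C_f/log U) ≤ ∑_{U < p ≤ V, p prime} |R_p(x)|`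
  (each prime `p > 2dN` has `2ρ_f(p)N ≤ 2dN < p`, so `|R_p| ≥ ρ_f(p)N/p` by
  `rootCount_mul_div_le_abs_remainder`);
* `monic_level_le_one` — the headline: for every `ε > 0` there is `N₀` such that for all
  `N ≥ N₀`, all `V ≥ N^{1+ε}` and all admissible `x`,
  `(log(1+ε)/2) · N ≤ ∑_{2dN < p ≤ V, p prime} |R_p(x)|`.

So for every monic irreducible `f` of degree `d` the remainder sum up to level `N^{1+ε}`
(`= x^{(1+ε)/d}` in terms of the size `x ≍ N^d` of the members) is NOT `o(N) = o(X)`, whereas level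
`N^{1−ε}` holds (`SoloBlindLevel.sum_abs_remainder_le_linear`): the ℓ¹ Type-I range of a
one-variable polynomial sequence is exactly `γ = 1/d` in the normalisation of Ford–Maynard
(arXiv:2407.14368, §1), for every degree.  In particular hypothesis (R) of Friedlander–Iwaniec's
asymptotic sieve for primes ((R1): `x^{2/3} < D`) and the level-`x^{1−ε}` hypothesis of Bombieri's
asymptotic sieve fail for all of them once `d ≥ 2`.

Everything is over existing declarations; no definition, no named fact, no `sorry`.  The only
non-elementary input is the tree's PROVED Mertens law for `ρ_f` (prime ideal theorem for the
field `ℚ[X]/(f)`).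

References.  G. Greaves, *Sieves in Number Theory*, Springer (2001), Ch. 5, p. 135 (level `D` and
degree `g`: `a ∈ 𝒜 ⇒ a < D^g`).  K. Ford, J. Maynard, arXiv:2407.14368 (2024), §1.
-/

noncomputable section

open Finset Real Polynomial
open Literature.NumberTheory.Sieve

namespace Summit.Parity.BatemanHorn.Theorems.SoloBlindLevel

/-- A window sum over the primes of `(U, V]` is a difference of two sums over `Nat.primesLE`. -/
theorem sum_Ioc_filter_prime_eq_sub (h : ℕ → ℝ) {U V : ℕ} (hUV : U ≤ V) :
    ∑ p ∈ (Ioc U V).filter Nat.Prime, h p =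
      ∑ p ∈ Nat.primesLE V, h p - ∑ p ∈ Nat.primesLE U, h p := by
  have hsplit : ∀ W : ℕ, ∑ p ∈ Nat.primesLE W, h p =
      ∑ k ∈ Icc 0 W, (if k.Prime then h k else 0) := by
    intro W
    rw [Nat.primesLE_eq_filter_range, Finset.sum_filter, Nat.range_succ_eq_Icc_zero]
  have hIcc : Icc 0 V = Icc 0 U ∪ Ioc U V := by
    ext k
    simp only [Finset.mem_union, Finset.mem_Icc, Finset.mem_Ioc]
    omega
  have hdisj : Disjoint (Icc 0 U) (Ioc U V) :=
    Finset.disjoint_left.mpr fun k hk1 hk2 => by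
      rw [Finset.mem_Icc] at hk1
      rw [Finset.mem_Ioc] at hk2
      omega
  rw [hsplit, hsplit, Finset.sum_filter, hIcc, Finset.sum_union hdisj]
  ring

/-- **Mertens' law for `ρ_f`, monic irreducible `f`** (the tree's
`DegreeOnePrimes.sum_primesLE_rootCount_div_eq` with `A = 0`, restated with `polyRootCountMod`):
`|∑_{p ≤ x} ρ_f(p)/p − (log log x + c)| ≤ C / log x` for `x ≥ 2`. -/
theorem mertens_rootCount {g : ℤ[X]} (hg : g.Monic) (hirr : Irreducible g) :
    ∃ c C : ℝ, ∀ x : ℝ, 2 ≤ x →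
      |∑ p ∈ Nat.primesLE ⌊x⌋₊, (polyRootCountMod ![g] p : ℝ) / p -
          (Real.log (Real.log x) + c)| ≤ C / Real.log x := by
  obtain ⟨c, C, h⟩ :=
    Literature.NumberTheory.LFunctions.DegreeOnePrimes.sum_primesLE_rootCount_div_eq hg hirr 0
  refine ⟨c, C, fun x hx => ?_⟩
  have := h x hx
  simp only [card_filter_dvd_eval_eq_polyRootCountMod, zero_add, pow_one] at this
  exact this

/-- **The window lower bound, monic irreducible `f` of degree `d ≥ 1`.** With `c, C` as in
`mertens_rootCount`: for `2 ≤ U`, `2dN ≤ U ≤ V` and admissible `x`,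
`N · (log log V − log log U − C/log V − C/log U) ≤ ∑_{U < p ≤ V, p prime} |R_p(x)|`. -/
theorem monic_window {g : ℤ[X]} (hirr : Irreducible g) (hdeg : 0 < g.natDegree)
    {c C : ℝ} (hM : ∀ x : ℝ, 2 ≤ x →
      |∑ p ∈ Nat.primesLE ⌊x⌋₊, (polyRootCountMod ![g] p : ℝ) / p -
          (Real.log (Real.log x) + c)| ≤ C / Real.log x)
    {N U V : ℕ} (hU2 : 2 ≤ U) (hU : 2 * g.natDegree * N ≤ U) (hUV : U ≤ V) {x : ℝ}
    (hx : ∀ n ∈ apIndex N 1 0, 0 < g.eval (n : ℤ) ∧ ((g.eval (n : ℤ) : ℤ) : ℝ) ≤ x) :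
    (N : ℝ) * (Real.log (Real.log V) - Real.log (Real.log U) - C / Real.log V - C / Real.log U) ≤
      ∑ p ∈ (Ioc U V).filter Nat.Prime, |(polyAPSeq g N 1 0).remainder p x| := by
  set S := (Ioc U V).filter Nat.Prime with hSdef
  -- the moduli of `S` are admissible
  have hS : ∀ m ∈ S, 0 < m ∧ 2 * ((polyRootCountMod ![g] m : ℝ) * N) ≤ m := by
    intro m hm
    rw [hSdef, Finset.mem_filter, Finset.mem_Ioc] at hm
    obtain ⟨⟨hUm, -⟩, hp⟩ := hm
    refine ⟨hp.pos, ?_⟩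
    have hd : (polyRootCountMod ![g] m : ℝ) ≤ g.natDegree := by
      exact_mod_cast polyRootCountMod_prime_le_natDegree_of_irreducible hirr hdeg hp
    have hm' : (U : ℝ) < m := by exact_mod_cast hUm
    have hN' : (2 : ℝ) * g.natDegree * N ≤ U := by exact_mod_cast hU
    have hN0 : (0 : ℝ) ≤ N := Nat.cast_nonneg N
    nlinarith [hd, hm', hN', hN0]
  -- the window sum of `ρ_f(p)/p`
  have hU2' : (2 : ℝ) ≤ U := by exact_mod_cast hU2
  have hV2' : (2 : ℝ) ≤ V := hU2'.trans (by exact_mod_cast hUV)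
  have hsum : Real.log (Real.log V) - Real.log (Real.log U) - C / Real.log V - C / Real.log U ≤
      ∑ p ∈ S, (polyRootCountMod ![g] p : ℝ) / p := by
    rw [hSdef, sum_Ioc_filter_prime_eq_sub (fun p => (polyRootCountMod ![g] p : ℝ) / p) hUV]
    have h1 := hM V hV2'
    have h2 := hM U hU2'
    rw [Nat.floor_natCast] at h1 h2
    have h1' := (abs_le.mp h1).1
    have h2' := (abs_le.mp h2).2
    linarith
  calc (N : ℝ) * (Real.log (Real.log V) - Real.log (Real.log U) - C / Real.log V - C / Real.log U)
      ≤ (N : ℝ) * ∑ p ∈ S, (polyRootCountMod ![g] p : ℝ) / p :=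
        mul_le_mul_of_nonneg_left hsum (Nat.cast_nonneg N)
    _ ≤ ∑ p ∈ S, |(polyAPSeq g N 1 0).remainder p x| :=
        mul_sum_rootCount_div_le_sum_abs_remainder g S hS hx

/-- **Headline: the ℓ¹ level of `{f(n) : n ≤ N}` does not exceed `N`, for every monic irreducible
`f` of degree `d ≥ 1`.** For every `ε > 0` there is `N₀` such that for all `N ≥ N₀`, all
`V ≥ N^{1+ε}` and all admissible `x`:
`(log(1+ε)/2) · N ≤ ∑_{2dN < p ≤ V, p prime} |R_p(x)|`. -/
theorem monic_level_le_one {g : ℤ[X]} (hg : g.Monic) (hirr : Irreducible g)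
    (hdeg : 0 < g.natDegree) {ε : ℝ} (hε : 0 < ε) :
    ∃ N₀ : ℕ, ∀ N : ℕ, N₀ ≤ N → ∀ V : ℕ, (N : ℝ) ^ (1 + ε) ≤ V → ∀ x : ℝ,
      (∀ n ∈ apIndex N 1 0, 0 < g.eval (n : ℤ) ∧ ((g.eval (n : ℤ) : ℤ) : ℝ) ≤ x) →
      Real.log (1 + ε) / 2 * N ≤
        ∑ p ∈ (Ioc (2 * g.natDegree * N) V).filter Nat.Prime,
          |(polyAPSeq g N 1 0).remainder p x| := by
  obtain ⟨c, C, hM⟩ := mertens_rootCount hg hirr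
  -- `C ≥ 0` (take `x = 2`)
  have hlog2 : 0 < Real.log 2 := Real.log_pos (by norm_num)
  have hC0 : 0 ≤ C := by
    by_contra hneg
    have h := (abs_nonneg _).trans (hM 2 le_rfl)
    have : C / Real.log 2 < 0 := div_neg_of_neg_of_pos (not_le.mp hneg) hlog2
    linarith
  set d : ℕ := g.natDegree with hd
  have hd1 : (1 : ℝ) ≤ d := by exact_mod_cast hdeg
  have h2d : (2 : ℝ) ≤ 2 * (d : ℝ) := by linarith
  set B : ℝ := Real.log (2 * (d : ℝ)) with hB
  have hB0 : 0 < B := Real.log_pos (by linarith)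
  set K : ℝ := B + 2 * C with hK
  have hK0 : 0 < K := by rw [hK]; linarith
  have hlε : 0 < Real.log (1 + ε) := Real.log_pos (by linarith)
  have hlε' : Real.log (1 + ε) ≤ ε := by
    have := Real.log_le_sub_one_of_pos (show (0 : ℝ) < 1 + ε by linarith)
    linarith
  set L : ℝ := 2 * K / Real.log (1 + ε) with hL
  obtain ⟨N₀, hN₀⟩ := exists_nat_ge (Real.exp L + 2)
  refine ⟨N₀, fun N hN V hV x hx => ?_⟩
  have hN₀N : (N₀ : ℝ) ≤ N := by exact_mod_cast hN
  have hexp : 0 < Real.exp L := Real.exp_pos L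
  have hN2 : (2 : ℝ) ≤ N := by linarith
  have hNpos : (0 : ℝ) < N := by linarith
  -- `log N ≥ L`, i.e. `log(1+ε) · log N ≥ 2K`
  have hlogN : L ≤ Real.log N := by
    rw [← Real.log_exp L]
    exact Real.log_le_log hexp (by linarith)
  have hA : 2 * K ≤ Real.log (1 + ε) * Real.log N := by
    have := (div_le_iff₀ hlε).mp hlogN
    linarith
  have hlogNpos : 0 < Real.log N := Real.log_pos (by linarith)
  have hεA : B ≤ ε * Real.log N := by nlinarith
  -- `log V ≥ (1 + ε) log N`
  have hrpow : 0 < (N : ℝ) ^ (1 + ε) := Real.rpow_pos_of_pos hNpos _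
  have hVpos : (0 : ℝ) < V := hrpow.trans_le hV
  have hlogV : (1 + ε) * Real.log N ≤ Real.log V := by
    rw [← Real.log_rpow hNpos]
    exact Real.log_le_log hrpow hV
  have hlogVpos : 0 < Real.log V := by nlinarith
  -- the window `U = 2dN`
  have hUcast : ((2 * d * N : ℕ) : ℝ) = 2 * (d : ℝ) * N := by push_cast; ring
  have hU2 : 2 ≤ 2 * d * N := by
    have : (2 : ℝ) ≤ 2 * (d : ℝ) * N := by nlinarith
    rw [← hUcast] at this
    exact_mod_cast this
  have hUV : 2 * d * N ≤ V := by
    have h2dε : 2 * (d : ℝ) ≤ (N : ℝ) ^ ε := by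
      rw [← Real.log_le_log_iff (by linarith) (Real.rpow_pos_of_pos hNpos ε), Real.log_rpow hNpos]
      exact hεA
    have : 2 * (d : ℝ) * N ≤ (N : ℝ) ^ (1 + ε) := by
      rw [Real.rpow_add hNpos, Real.rpow_one]
      nlinarith
    have h' : ((2 * d * N : ℕ) : ℝ) ≤ V := by rw [hUcast]; exact this.trans hV
    exact_mod_cast h'
  have hwin := monic_window hirr hdeg hM hU2 (le_refl (2 * d * N)) hUV hx
  -- `log U = B + log N`, `log log U ≤ log log N + B / log N`
  have hlogU : Real.log ((2 * d * N : ℕ) : ℝ) = B + Real.log N := by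
    rw [hUcast, hB]
    exact Real.log_mul (by linarith) hNpos.ne'
  have hllU : Real.log (Real.log ((2 * d * N : ℕ) : ℝ)) ≤
      Real.log (Real.log N) + B / Real.log N := by
    rw [hlogU]
    have hfac : B + Real.log N = Real.log N * (1 + B / Real.log N) := by
      field_simp
      ring
    rw [hfac, Real.log_mul hlogNpos.ne' (by positivity)]
    have := Real.log_le_sub_one_of_pos (show (0 : ℝ) < 1 + B / Real.log N by positivity)
    linarith
  -- `log log V ≥ log(1+ε) + log log N`
  have hllV : Real.log (1 + ε) + Real.log (Real.log N) ≤ Real.log (Real.log V) := by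
    rw [← Real.log_mul (by linarith) hlogNpos.ne']
    exact Real.log_le_log (by positivity) hlogV
  -- `C / log V ≤ C / log N`, `C / log U ≤ C / log N`
  have hCV : C / Real.log V ≤ C / Real.log N :=
    div_le_div_of_nonneg_left hC0 hlogNpos (by nlinarith)
  have hCU : C / Real.log ((2 * d * N : ℕ) : ℝ) ≤ C / Real.log N := by
    refine div_le_div_of_nonneg_left hC0 hlogNpos ?_
    rw [hlogU]; linarith
  -- `K / log N ≤ log(1+ε)/2`
  have hKA : B / Real.log N + 2 * (C / Real.log N) ≤ Real.log (1 + ε) / 2 := by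
    rw [show B / Real.log N + 2 * (C / Real.log N) = K / Real.log N by rw [hK]; ring]
    rw [div_le_iff₀ hlogNpos]
    linarith
  have key : Real.log (1 + ε) / 2 ≤
      Real.log (Real.log V) - Real.log (Real.log ((2 * d * N : ℕ) : ℝ)) -
        C / Real.log V - C / Real.log ((2 * d * N : ℕ) : ℝ) := by
    linarith
  calc Real.log (1 + ε) / 2 * N = (N : ℝ) * (Real.log (1 + ε) / 2) := mul_comm _ _
    _ ≤ (N : ℝ) * (Real.log (Real.log V) - Real.log (Real.log ((2 * d * N : ℕ) : ℝ)) -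
        C / Real.log V - C / Real.log ((2 * d * N : ℕ) : ℝ)) :=
        mul_le_mul_of_nonneg_left key hNpos.le
    _ ≤ _ := hwin

end Summit.Parity.BatemanHorn.Theorems.SoloBlindLevel

end
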